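import Literature.Barriers.FinalStateConjecture.KleinGordonSuperradiantInstabilityProofs
import Literature.Geometry.Lorentzian.KerrStarChartBounds
import Mathlib.Analysis.SpecialFunctions.ExpDeriv
import HarnessLib

/-!
# Barrier catalogue `FinalStateConjecture`: Shlapentokh-Rothman's unstable Klein–Gordon modes —
# decomposition of the profile fact `ShlapentokhRothman2014_unstableModeProfile` into the
# printed separated mode theorem (Thm. 1.2, Boyer–Lindquist form) and Carter separation on the
# Kerr–Schild leaf
(`Literature/Barriers/FinalStateConjecture/`, D-0021, D-0014; family `gr`; namespace
`Literature.Barriers.FinalStateConjecture`)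

`KleinGordonSuperradiantInstabilityProofs.lean` reduces the barrier fact
`KleinGordonSuperradiantInstability` (SR, CMP 329 (2014), Thm. 1.1, energy form) to the named fact
`ShlapentokhRothman2014_unstableModeProfile`: a mass `μ`, a frequency `ω` (`Im ω > 0`) and a smooth,
non-zero, exponentially decaying profile `Φ` on the Kerr–Schild leaf solving the reduced equation
`P_ω Φ = μ² Φ` (`reducedWaveOp`). Discharging that fact is theory-sized (triage **XL**): the printed
proof of the mode theorem (Thm. 1.2) is one-dimensional analysis in the separated variables
`ψ = e^{−iωt} e^{imφ} S(θ) R(r)` of Boyer–Lindquist coordinates (§2: the angular ODE (2.1), the radial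
ODE (2.2), horizon regularity (2.3)–(2.4), finite energy (2.5); App. A–C: regular singular points,
the angular eigencurves, the local theory of the radial ODE; §4: variational real modes, the
implicit-function perturbation, superradiance), while the vendored profile form lives in the
Cartesian ingoing Kerr–Schild chart of the prelude. This file performs the first, purely
geometric layer of the decomposition and proves the glue:

* **the separated objects of §2**, as definitions: the radial potential `V_μ`
  (`kgRadialPotential`), the predicates "`R` solves (2.2) on `(r₊, ∞)`" (`IsRadialSolution`),
  "`S` solves (2.1) on `(0, π)`" (`IsAngularSolution`), "`Y` is the smooth degree-`0`-homogeneous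
  extension of `e^{imφ} S(θ)`" (`IsSphericalExtension`, the Cartesian rendering of
  "`e^{imφ}S_{ml}(θ)` extends smoothly to `𝕊²`"), and the **Kerr–Schild-leaf transcription** of a
  separated mode: since the prelude chart is SR's Kerr-star chart with `t* = t_KS + r` and `φ*`
  the azimuth of Kerr's ingoing spheroidal coordinates (`Kerr.kerrStar`, `Kerr.radius_kerrStar`,
  `Kerr.nullSpatial_kerrStar : ℓ⃗ = n̂(θ, φ*)` of `KerrStarCoord.lean`), the Boyer–Lindquist mode
  `e^{−iωt}e^{imφ}S R` equals `e^{−iωt_KS} Φ(y)` with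
  `Φ(y) = e^{i(ω(t̄(r) − r) − m φ̄(r))} R(r) · Y(ℓ⃗(0, y))`, `r = r(0, y)` (`ksPhase`, `ksRadial`,
  `ksProfile`); under (2.3), `e^{i(ω(t̄ − r) − mφ̄)} R = e^{−iωr} f` (`ksRadial_eq`);
* the named fact **`CarterSeparationKSLeaf`**: if `S` solves (2.1), `Y` is its smooth spherical
  extension and `R` solves (2.2), then `P_ω Φ = μ² Φ` on the leaf `Kerr.slice a r₊` — Carter's
  separability of the Klein–Gordon equation on Kerr (CMP 10 (1968)), as printed in SR §2
  ("In order for `ψ` to satisfy the Klein–Gordon equation, `S_{ml}` and `R` must satisfy (2.1),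
  (2.2)"), transcribed to the Kerr–Schild leaf by the chart identity above and
  `□_g(e^{−iωt_KS}Φ) = e^{−iωt_KS}P_ωΦ` (`dalembertian_modeRe`);
* the named fact **`ShlapentokhRothman2014_separatedMode`**: SR's Theorem 1.2 read at one small
  `ε > 0`, in the printed separated form — parameters `(ω, m, λ, μ)` with `Im ω > 0`, `Re ω ≠ 0`,
  superradiant, mass `δ`-close to `|am|/(2Mr₊)`; an angular eigenfunction `S` of (2.1) with smooth
  spherical extension; a radial solution `R` of (2.2) on `(r₊, ∞)` with the horizon behaviour (2.3)
  (`R = e^{−i(ωt̄ − mφ̄)} f`, `f` smooth up to and across `r₊`), not identically zero, with `R`, `R'`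
  exponentially decaying at infinity (finite energy (2.5) and Lemma C.1/§4.2);
* **proved glue**: smoothness of `ksProfile` on the leaf (`contDiffOn_ksProfile`), non-vanishing
  (`ksProfile_kerrStar`), exponential decay of the leaf radial factor and of its derivative on
  `(r₊, ∞)` from (2.3) near the horizon and from `t̄(r) − r ≥ −2Mr₋` at infinity
  (`exists_bound_ksRadial`), decay of the profile and of its Fréchet derivative on the leaf
  (`exists_decay_ksProfile`, using the uniform chart bounds of `KerrStarChartBounds.lean` and
  `r ≥ ‖y‖ − |a|`), and the reduction
  `ShlapentokhRothman2014_unstableModeProfile.of_separated :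
    CarterSeparationKSLeaf → ShlapentokhRothman2014_separatedMode →
      ShlapentokhRothman2014_unstableModeProfile`
  (hence `KleinGordonSuperradiantInstability.of_separated`).

What is NOT here (the remaining decomposition, recorded in the unit notes): the proof of
`CarterSeparationKSLeaf` — by `reducedWaveOp_eq` (`KleinGordonSuperradiantInstabilityReduced.lean`,
`P_ω = Δ + ω²(1 + 2H) − 4iωH∂_ℓ − 2iωM/Σ − (2M/Σ)∂_ℓ − 2H D²(ℓ⃗, ℓ⃗)`, equivalently
`P_ω = Δ + ω² − 2H(iω + ∂_ℓ)² − 2(M/Σ)(iω + ∂_ℓ)`) and `Kerr.laplacian_kerrStar` it is the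
one-variable computation "KS-leaf radial ODE for `e^{i(ω(t̄−r)−mφ̄)}R`:
`(Δw')' + 2i(am − 2Mωr)w' + (ω²(r² + 2Mr) − μ²r² − λ − 2iMω)w = 0` ⟺ (2.2) for `R`" plus the
spherical Laplacian of the degree-`0` extension `Y` — and the analytic sub-results of
`ShlapentokhRothman2014_separatedMode` (Props. B.1–B.3, Lemmas A.1, C.1, Props. 4.1–4.2, §4.3 with
Lemma 4.5, Prop. 4.6, Thm. 1.3 (3)).

## References

* Y. Shlapentokh-Rothman, *Exponentially growing finite energy solutions for the Klein–Gordon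
  equation on sub-extremal Kerr spacetimes*, Comm. Math. Phys. 329 (2014) 859–891,
  arXiv:1302.3448: §1.2.1 (Kerr-star coordinates), §1.3 Thm. 1.2, Thm. 1.3, §2 (mode solutions,
  (2.1)–(2.5)), §3.1 and §4.2 ("if a solution of the radial ODE is not exponentially decreasing,
  then it is exponentially increasing"), App. C Lemma C.1 (= Lemma 9.1 of the held copy
  `paper:arxiv-1302.3448`, whose appendices are numbered §7–§9) (key
  `ShlapentokhRothman2014KleinGordon`).
* B. Carter, *Hamilton–Jacobi and Schrödinger separable solutions of Einstein's equations*, Comm.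
  Math. Phys. 10 (1968) 280–310 (separability of the wave/Klein–Gordon equation on Kerr) (key
  `Carter1968`).
* M. Dafermos, I. Rodnianski, *Lectures on black holes and linear waves*, arXiv:0811.0354, §5.1.
-/

noncomputable section

open Set Filter
open scoped Topology Real ContDiff

namespace Literature.Barriers.FinalStateConjecture

open Literature.Geometry.Lorentzian

/-! ### The separated equations of SR §2 -/

/-- The **radial potential** `V_μ(r)` of the radial ODE (2.2):
`V_μ = −(r² + a²)² ω² + 4Mamrω − a²m² + Δ (λ + a²ω² + μ² r²)` (complex `ω`, `λ`).
Shlapentokh-Rothman, CMP 329 (2014), §2 (2.2). [cite: ShlapentokhRothman2014KleinGordon, §2 (2.2)] -/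
def kgRadialPotential (M a : ℝ) (w : ℂ) (m : ℤ) (Λ : ℂ) (μ : ℝ) (r : ℝ) : ℂ :=
  -(((r ^ 2 + a ^ 2) ^ 2 : ℝ) : ℂ) * w ^ 2 + ((4 * M * a * m * r : ℝ) : ℂ) * w -
    ((a ^ 2 * (m : ℝ) ^ 2 : ℝ) : ℂ) +
    ((Kerr.delta M a r : ℝ) : ℂ) * (Λ + ((a ^ 2 : ℝ) : ℂ) * w ^ 2 + ((μ ^ 2 * r ^ 2 : ℝ) : ℂ))

/-- **`R` solves the radial ODE (2.2) on `(r₊, ∞)`**: `R` is smooth on `(r₊, ∞)` (solutions of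
the linear ODE (2.2), whose coefficients are polynomial with `Δ ≠ 0` there, are real-analytic; we
record `C^∞`) and `Δ (Δ R')' − V_μ R = 0` (`Δ = r² − 2Mr + a²`, `Kerr.delta`; derivatives as
one-variable `deriv`s). Shlapentokh-Rothman, CMP 329 (2014), §2 (2.2).
[cite: ShlapentokhRothman2014KleinGordon, §2 (2.2)] -/
def IsRadialSolution (M a : ℝ) (w : ℂ) (m : ℤ) (Λ : ℂ) (μ : ℝ) (R : ℝ → ℂ) : Prop :=
  ContDiffOn ℝ ∞ R (Ioi (Kerr.rPlus M a)) ∧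
  ∀ r ∈ Ioi (Kerr.rPlus M a),
    ((Kerr.delta M a r : ℝ) : ℂ) * deriv (fun s ↦ ((Kerr.delta M a s : ℝ) : ℂ) * deriv R s) r =
      kgRadialPotential M a w m Λ μ r * R r

/-- **`S` solves the angular ODE (2.1) on `(0, π)`** with eigenvalue `λ` and oblateness
parameter `κ = a²(ω² − μ²)`: `S` is smooth on `(0, π)` (solutions of the linear ODE (2.1), with
analytic coefficients on `(0, π)`, are real-analytic; we record `C^∞`) and
`(1/sin θ) (sin θ S')' − (m²/sin²θ − a²(ω² − μ²) cos²θ) S + λ S = 0` there (derivatives as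
one-variable `deriv`s). Shlapentokh-Rothman, CMP 329 (2014), §2 (2.1) and App. B.
[cite: ShlapentokhRothman2014KleinGordon, §2 (2.1)] -/
def IsAngularSolution (a : ℝ) (w : ℂ) (μ : ℝ) (m : ℤ) (Λ : ℂ) (S : ℝ → ℂ) : Prop :=
  ContDiffOn ℝ ∞ S (Ioo 0 π) ∧
  ∀ θ ∈ Ioo 0 π,
    deriv (fun t ↦ ((Real.sin t : ℝ) : ℂ) * deriv S t) θ / ((Real.sin θ : ℝ) : ℂ) -
      ((((m : ℝ) ^ 2 / Real.sin θ ^ 2 : ℝ) : ℂ) -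
        ((a ^ 2 : ℝ) : ℂ) * (w ^ 2 - ((μ ^ 2 : ℝ) : ℂ)) * ((Real.cos θ ^ 2 : ℝ) : ℂ)) * S θ +
      Λ * S θ = 0

/-- **Smoothness of `e^{imφ} S(θ)` on the sphere, Cartesian form**: `Y : E3 → ℂ` is `C^∞` on
`E3 ∖ {0}`, homogeneous of degree `0`, and restricts on the unit sphere to
`Y(n̂(θ, φ)) = e^{imφ} S(θ)` for `θ ∈ (0, π)` (a function on `𝕊²` is smooth iff its degree-`0`
homogeneous extension to `ℝ³ ∖ {0}` is). This renders "imposing the condition that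
`e^{imφ}S_{ml}(θ)` extends to `𝕊²`" of Shlapentokh-Rothman, CMP 329 (2014), §2.
[cite: ShlapentokhRothman2014KleinGordon, §2] -/
def IsSphericalExtension (m : ℤ) (S : ℝ → ℂ) (Y : E3 → ℂ) : Prop :=
  ContDiffOn ℝ ∞ Y {n : E3 | n ≠ 0} ∧
  (∀ n : E3, n ≠ 0 → ∀ t : ℝ, 0 < t → Y (t • n) = Y n) ∧
  ∀ θ ∈ Ioo 0 π, ∀ φ : ℝ,
    Y (sphRadial θ φ) = Complex.exp ((((m : ℝ) * φ : ℝ) : ℂ) * Complex.I) * S θ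

/-! ### The Kerr–Schild-leaf transcription of a separated mode -/

/-- The **leaf phase** `e^{i(ω(t̄(r) − r) − m φ̄(r))}` relating a Boyer–Lindquist mode to its
Kerr–Schild-leaf profile: `e^{−iωt} e^{imφ} = e^{−iωt_KS} · e^{i(ω(t̄ − r) − mφ̄)} · e^{imφ*}` for
`t = t_KS + r − t̄(r)`, `φ = φ* − φ̄(r)` (SR §1.2.1; `Kerr.starTime`, `Kerr.starAngle`).
[cite: ShlapentokhRothman2014KleinGordon, §1.2.1 and §2 (2.3)] -/
def ksPhase (M a : ℝ) (w : ℂ) (m : ℤ) (r : ℝ) : ℂ :=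
  Complex.exp (Complex.I * (w * ((Kerr.starTime M a r - r : ℝ) : ℂ) -
    (m : ℂ) * ((Kerr.starAngle M a r : ℝ) : ℂ)))

/-- The **leaf radial factor** `w(r) = e^{i(ω(t̄(r) − r) − m φ̄(r))} R(r)` of a separated mode
(equal to `e^{−iωr} f(r)` under the horizon form (2.3) `R = e^{−i(ωt̄ − mφ̄)} f`, `ksRadial_eq`).
[cite: ShlapentokhRothman2014KleinGordon, §2 (2.3)] -/
def ksRadial (M a : ℝ) (w : ℂ) (m : ℤ) (R : ℝ → ℂ) (r : ℝ) : ℂ :=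
  ksPhase M a w m r * R r

/-- The **leaf profile** `Φ(y) = g(r(0, y)) · Y(ℓ⃗(0, y))` assembled from a radial factor `g` and
an angular factor `Y` (Kerr–Schild radius `Kerr.radius`, spatial null vector `Kerr.nullSpatial`,
which on the leaf is the round unit vector `n̂(θ, φ*)` of the Kerr-star angles,
`Kerr.nullSpatial_kerrStar`). SR §1.3 (1.5) with §1.2.1. [cite: ShlapentokhRothman2014KleinGordon, §1.3 (1.5)] -/
def ksProfile (a : ℝ) (g : ℝ → ℂ) (Y : E3 → ℂ) (y : E3) : ℂ :=
  g (Kerr.radius a (E4.ofTimeSpace 0 y)) * Y (Kerr.nullSpatial a (E4.ofTimeSpace 0 y))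

/-! ### The two named facts -/

/-- **Carter separation on the Kerr–Schild leaf** (named fact). Shlapentokh-Rothman, CMP 329
(2014), §2, as printed: "we work in Boyer–Lindquist coordinates and consider solutions of the form
`ψ(t, r, θ, φ) = e^{−iωt}e^{imφ}S_{ml}(θ)R(r)` with `ω ∈ ℂ`. In order for `ψ` to satisfy the
Klein–Gordon equation, `S_{ml}` and `R` must satisfy" the angular ODE (2.1) and the radial ODE
(2.2) — Carter's separability of `(□_g − μ²)` on Kerr (Carter, CMP 10 (1968)): for such `S`, `R`,
`(□_g − μ²)ψ = 0` on `{r > r₊}`. **Vendored form** (transcription to the prelude chart): for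
sub-extremal `(M, a)`, any `ω, λ ∈ ℂ`, `m ∈ ℤ`, `μ ∈ ℝ`, if `S` solves (2.1) on `(0, π)`
(`IsAngularSolution`), `Y` is the smooth degree-`0` extension of `e^{imφ}S` (`IsSphericalExtension`)
and `R` solves (2.2) on `(r₊, ∞)` (`IsRadialSolution`), then the leaf profile
`Φ(y) = e^{i(ω(t̄ − r) − mφ̄)} R(r) Y(ℓ⃗(0, y))` (`ksProfile a (ksRadial M a ω m R) Y`) satisfies the
reduced equation `P_ω Φ = μ² Φ` (`reducedWaveOp`) at every point of `Kerr.slice a r₊`. Rendering: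
the prelude's ingoing Kerr–Schild Cartesian chart is SR's Kerr-star chart (§1.2.1) with
`t* = t_KS + r`, `φ* =` the azimuth of `Kerr.kerrStar` (`Kerr.nullSpatial_kerrStar`,
`Kerr.radius_kerrStar`; `ℓ = dt* − a sin²θ dφ*`, `η + 2Hℓ⊗ℓ` = the printed Kerr-star metric), so
`ψ = e^{−iωt_KS}Φ`; and `□_g(e^{−iωt_KS}Φ) = e^{−iωt_KS} P_ωΦ` (`dalembertian_modeRe`), whence
`(□_g − μ²)ψ = 0 ⟺ P_ωΦ = μ²Φ`. Not yet proved here: with `reducedWaveOp_eq`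
(`KleinGordonSuperradiantInstabilityReduced.lean`: `P_ω` in terms of the flat Laplacian, `H`, `ℓ⃗`)
and the flat Laplacian in Kerr's spheroidal coordinates (`Kerr.laplacian_kerrStar`, where
`ℓ⃗ = ∂_r`), it reduces along `Kerr.kerrStar` to the conjugation `e^{i(ω(t̄−r)−mφ̄)}` of (2.2) and the
spherical form of (2.1), and passes to the axis by continuity (`Kerr.eqOn_slice_of_offAxis`).
[cite: ShlapentokhRothman2014KleinGordon, §2 (2.1)–(2.2); Carter1968] -/
def CarterSeparationKSLeaf : Prop :=
  ∀ (M a : ℝ), Kerr.IsSubextremal M a →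
    ∀ (w : ℂ) (m : ℤ) (Λ : ℂ) (μ : ℝ) (S : ℝ → ℂ) (Y : E3 → ℂ) (R : ℝ → ℂ),
      IsAngularSolution a w μ m Λ S → IsSphericalExtension m S Y → IsRadialSolution M a w m Λ μ R →
        ∀ y ∈ Kerr.slice a (Kerr.rPlus M a),
          reducedWaveOp M a w (ksProfile a (ksRadial M a w m R) Y) y =
            μ ^ 2 * ksProfile a (ksRadial M a w m R) Y y

/-- **Shlapentokh-Rothman's mode theorem, separated (printed) form** (named fact).
Shlapentokh-Rothman, Comm. Math. Phys. 329 (2014), Thm. 1.2: "Fix a sub-extremal Kerr spacetime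
with mass `M` and angular momentum `aM`. Let `m ∈ ℤ` and `ω₀ ∈ ℝ` satisfy `am − 2Mr₊ω₀ = 0` and
`am ≠ 0`. Then, for each `l` and sufficiently small `δ > 0`, there exists `μ(0) > |ω_R(0)|`, real
analytic `ω_R(ε)`, and real analytic `μ(ε)` such that for every `−δ < ε < δ`, there exists a mode
solution with parameters `(ω_R(ε) + iε, m, l, μ(ε))`. These unstable modes must all be superradiant
`|am| − 2Mr₊√(ω_R²(ε) + ε²) > 0`. Lastly, the modes lose mass as they become unstable
`∂μ/∂ε(0) < 0`." A *mode solution* (§2) is `ψ = e^{−iωt}e^{imφ}S_{ml}(θ)R(r)` with `S_{ml}` an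
eigenfunction of (2.1) such that `e^{imφ}S_{ml}` extends smoothly to `𝕊²`, `R` a solution of (2.2)
which extends smoothly to the horizon in Kerr-star coordinates, (2.3):
`R = e^{−i(ωt̄(r) − mφ̄(r))} f(r)` "where `f` extends smoothly to `r₊`", and has finite energy,
(2.5): `∫_{r₊+1}^∞ (|R|² + |R'|²) r² dr < ∞`, whence (§3.1, §4.2, App. C Lemma C.1: "all solutions
are either exponentially growing or exponentially decaying at infinity",
`ρ ~ e^{−√(μ²−ω²) r} r^{−1−M(2ω²−μ²)/√(μ²−ω²)}`) `R` and `R'` decay exponentially. Mass clause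
(Thm. 1.1, abstract): "For every non-zero integer `m`, `μ` can be chosen arbitrarily close to
`|am|/(2Mr₊)`".

**Vendored form** (the theorem read at one small `ε ∈ (0, δ)`, as in
`ShlapentokhRothman2014_unstableModeProfile`, deviations (iv)–(v) there): for sub-extremal `(M, a)` with
`a ≠ 0`, every integer `m ≠ 0` and every `δ > 0` there are `μ > 0` with `|μ − |am|/(2Mr₊)| < δ`,
`ω ∈ ℂ` with `Im ω > 0`, `Re ω ≠ 0`, `2Mr₊‖ω‖ < |am|`, an eigenvalue `λ ∈ ℂ`, an angular function
`S` solving (2.1) on `(0, π)`, not identically zero, with smooth spherical extension `Y` of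
`e^{imφ}S` (`IsSphericalExtension`), and radial functions `R`, `f` with: `R` solves (2.2) on
`(r₊, ∞)` (`IsRadialSolution`); `f` is `C^∞` on `(r₊ − η, ∞)` for some `η > 0` and
`R = e^{−i(ωt̄ − mφ̄)} f` on `(r₊, ∞)` ((2.3), with the explicit primitives `Kerr.starTime`,
`Kerr.starAngle` of `t̄' = (r² + a²)/Δ`, `φ̄' = a/Δ`); `R ≢ 0` on `(r₊, ∞)`; and
`‖R(r)‖, ‖R'(r)‖ ≤ C e^{−κr}` for `r ≥ r₊ + 1`, some `C`, `κ > 0`. Not vendored: the analytic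
families, all `l`, `∂μ/∂ε(0) < 0`, the precise decay rate.
[cite: ShlapentokhRothman2014KleinGordon, Thm. 1.2 with §2 (2.1)–(2.5) and App. C Lemma C.1; mass clause Thm. 1.1] -/
def ShlapentokhRothman2014_separatedMode : Prop :=
  ∀ (M a : ℝ), Kerr.IsSubextremal M a → a ≠ 0 → ∀ m : ℤ, m ≠ 0 → ∀ δ > (0 : ℝ),
    ∃ μ > (0 : ℝ), |μ - |a * m| / (2 * M * Kerr.rPlus M a)| < δ ∧
    ∃ w : ℂ, 0 < w.im ∧ w.re ≠ 0 ∧ 2 * M * Kerr.rPlus M a * ‖w‖ < |a * m| ∧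
    ∃ (Λ : ℂ) (S : ℝ → ℂ) (Y : E3 → ℂ),
      IsAngularSolution a w μ m Λ S ∧ IsSphericalExtension m S Y ∧ (∃ θ ∈ Ioo 0 π, S θ ≠ 0) ∧
    ∃ R f : ℝ → ℂ,
      IsRadialSolution M a w m Λ μ R ∧
      (∃ η > (0 : ℝ), ContDiffOn ℝ ∞ f (Ioi (Kerr.rPlus M a - η))) ∧
      (∀ r ∈ Ioi (Kerr.rPlus M a), R r =
        Complex.exp (-(Complex.I * (w * ((Kerr.starTime M a r : ℝ) : ℂ) -
          (m : ℂ) * ((Kerr.starAngle M a r : ℝ) : ℂ)))) * f r) ∧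
      (∃ r ∈ Ioi (Kerr.rPlus M a), R r ≠ 0) ∧
      ∃ C κ : ℝ, 0 < κ ∧ ∀ r : ℝ, Kerr.rPlus M a + 1 ≤ r →
        ‖R r‖ ≤ C * Real.exp (-(κ * r)) ∧ ‖deriv R r‖ ≤ C * Real.exp (-(κ * r))

/-! ### Glue, I: the leaf radial factor under the horizon form (2.3) -/

section Radial

variable {M a : ℝ} {w : ℂ} {m : ℤ} {R f : ℝ → ℂ}

/-- Under (2.3), `e^{i(ω(t̄ − r) − mφ̄)} R(r) = e^{−iωr} f(r)` on `(r₊, ∞)`. SR §2 (2.3).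
[cite: ShlapentokhRothman2014KleinGordon, §2 (2.3)] -/
theorem ksRadial_eq
    (hRf : ∀ r ∈ Ioi (Kerr.rPlus M a), R r =
      Complex.exp (-(Complex.I * (w * ((Kerr.starTime M a r : ℝ) : ℂ) -
        (m : ℂ) * ((Kerr.starAngle M a r : ℝ) : ℂ)))) * f r)
    {r : ℝ} (hr : r ∈ Ioi (Kerr.rPlus M a)) :
    ksRadial M a w m R r = Complex.exp (-(Complex.I * w) * (r : ℂ)) * f r := by
  rw [ksRadial, ksPhase, hRf r hr, ← mul_assoc, ← Complex.exp_add]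
  congr 1
  push_cast
  ring

/-- `‖e^{i(ω(t̄ − r) − mφ̄)}‖ = e^{−Im ω (t̄(r) − r)}`. [folklore] -/
theorem norm_ksPhase (M a : ℝ) (w : ℂ) (m : ℤ) (r : ℝ) :
    ‖ksPhase M a w m r‖ = Real.exp (-(w.im * (Kerr.starTime M a r - r))) := by
  rw [ksPhase, Complex.norm_exp]
  congr 1
  simp [Complex.mul_re, Complex.mul_im]

/-- **The leaf phase is bounded at infinity**: `‖e^{i(ω(t̄ − r) − mφ̄)}‖ ≤ e^{2Mr₋ Im ω}` for
`r ≥ r₊ + 1`, `Im ω ≥ 0` (`t̄ − r ≥ −2Mr₋`, `Kerr.neg_le_starTime_sub_self`). [folklore] -/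
theorem norm_ksPhase_le (hMa : Kerr.IsSubextremal M a) (hw : 0 ≤ w.im) (m : ℤ) {r : ℝ}
    (hr : Kerr.rPlus M a + 1 ≤ r) :
    ‖ksPhase M a w m r‖ ≤ Real.exp (2 * M * Kerr.rMinus M a * w.im) := by
  rw [norm_ksPhase, Real.exp_le_exp]
  have h := Kerr.neg_le_starTime_sub_self hMa hr
  nlinarith

/-- **Derivative of the leaf phase**: `d/dr e^{i(ω(t̄ − r) − mφ̄)} = i (2Mrω − am)/Δ · e^{…}` on
`(r₊, ∞)` (`t̄' − 1 = 2Mr/Δ`, `φ̄' = a/Δ`). [folklore] -/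
theorem hasDerivAt_ksPhase (hMa : Kerr.IsSubextremal M a) (w : ℂ) (m : ℤ) {r : ℝ}
    (hr : Kerr.rPlus M a < r) :
    HasDerivAt (ksPhase M a w m) (ksPhase M a w m r *
      (Complex.I * (w * (((r ^ 2 + a ^ 2) / Kerr.delta M a r - 1 : ℝ) : ℂ) -
        (m : ℂ) * ((a / Kerr.delta M a r : ℝ) : ℂ)))) r := by
  have h1 := ((Kerr.hasDerivAt_starTime hMa hr).sub (hasDerivAt_id r)).ofReal_comp
  have h2 := (Kerr.hasDerivAt_starAngle hMa hr).ofReal_comp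
  have h3 := ((h1.const_mul w).sub (h2.const_mul (m : ℂ))).const_mul Complex.I
  have h4 := h3.cexp
  unfold ksPhase
  convert h4 using 1
  · funext s
    simp
  · simp

/-- **Bound of the phase derivative factor at infinity**: for `r ≥ r₊ + 1`,
`‖i(ω(t̄' − 1) − mφ̄')‖ ≤ 2M‖ω‖(1 + r₊) + |am|` (`Δ ≥ r − r₋ ≥ 1` and `r ≤ (1 + r₊)(r − r₊)` there).
[folklore] -/
theorem norm_phaseFactor_le (hMa : Kerr.IsSubextremal M a) (w : ℂ) (m : ℤ) {r : ℝ}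
    (hr : Kerr.rPlus M a + 1 ≤ r) :
    ‖Complex.I * (w * (((r ^ 2 + a ^ 2) / Kerr.delta M a r - 1 : ℝ) : ℂ) -
        (m : ℂ) * ((a / Kerr.delta M a r : ℝ) : ℂ))‖ ≤
      2 * M * ‖w‖ * (1 + Kerr.rPlus M a) + |a * m| := by
  have hM : 0 < M := hMa.pos
  have hrp : 0 < Kerr.rPlus M a := hMa.rPlus_pos
  have h1 : 1 ≤ r - Kerr.rPlus M a := by linarith
  have h2 : 1 ≤ r - Kerr.rMinus M a := by linarith [hMa.rMinus_lt_rPlus]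
  have hΔ : Kerr.delta M a r = (r - Kerr.rPlus M a) * (r - Kerr.rMinus M a) :=
    Kerr.delta_eq_mul hMa.le r
  have hΔ1 : 1 ≤ Kerr.delta M a r := by rw [hΔ]; nlinarith
  have hΔpos : 0 < Kerr.delta M a r := by linarith
  have hfrac : (r ^ 2 + a ^ 2) / Kerr.delta M a r - 1 = 2 * M * r / Kerr.delta M a r := by
    rw [eq_div_iff hΔpos.ne', sub_mul, div_mul_cancel₀ _ hΔpos.ne', Kerr.delta]
    ring
  -- `r/Δ ≤ 1 + r₊`
  have hrΔ : r / Kerr.delta M a r ≤ 1 + Kerr.rPlus M a := by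
    rw [div_le_iff₀ hΔpos, hΔ]
    nlinarith [mul_le_mul (le_refl (r - Kerr.rPlus M a)) h2 zero_le_one (by linarith)]
  have hr0 : 0 ≤ r := by linarith
  rw [hfrac, norm_mul, Complex.norm_I, one_mul]
  refine (norm_sub_le _ _).trans ?_
  rw [norm_mul, norm_mul, Complex.norm_real, Complex.norm_real, Complex.norm_intCast,
    Real.norm_eq_abs, Real.norm_eq_abs, abs_of_nonneg (by positivity : 0 ≤ 2 * M * r / Kerr.delta M a r),
    abs_div, abs_of_pos hΔpos, abs_mul]
  have e1 : ‖w‖ * (2 * M * r / Kerr.delta M a r) ≤ 2 * M * ‖w‖ * (1 + Kerr.rPlus M a) := by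
    have : 2 * M * r / Kerr.delta M a r = 2 * M * (r / Kerr.delta M a r) := by ring
    rw [this]
    nlinarith [norm_nonneg w, mul_le_mul_of_nonneg_left hrΔ (by positivity : 0 ≤ 2 * M * ‖w‖)]
  have e2 : |(m : ℝ)| * (|a| / Kerr.delta M a r) ≤ |a| * |(m : ℝ)| := by
    rw [mul_comm]
    refine mul_le_mul_of_nonneg_right (div_le_self (abs_nonneg a) hΔ1) (abs_nonneg _)
  linarith

/-- **Exponential decay of the leaf radial factor and of its derivative** on all of `(r₊, ∞)`:
given the horizon form (2.3) with `f` smooth on `(r₊ − η, ∞)` and the decay of `R`, `R'` on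
`[r₊ + 1, ∞)` with rate `κ > 0` (and `Im ω ≥ 0`), there is `C'` with
`‖w(r)‖, ‖w'(r)‖ ≤ C' e^{−κr}` for all `r > r₊`, `w = ksRadial M a ω m R = e^{−iωr} f`
(near the horizon by continuity of `f`, `f'` on `[r₊, r₊ + 1]`; at infinity by
`‖e^{i(ω(t̄ − r) − mφ̄)}‖ ≤ e^{2Mr₋Im ω}` and the bound on its logarithmic derivative). This is
rendering deviation (iii) of `ShlapentokhRothman2014_unstableModeProfile`, proved. [folklore] -/
theorem exists_bound_ksRadial (hMa : Kerr.IsSubextremal M a) (hw : 0 ≤ w.im) {η C κ : ℝ}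
    (hη : 0 < η) (hκ : 0 < κ) (hf : ContDiffOn ℝ ∞ f (Ioi (Kerr.rPlus M a - η)))
    (hRf : ∀ r ∈ Ioi (Kerr.rPlus M a), R r =
      Complex.exp (-(Complex.I * (w * ((Kerr.starTime M a r : ℝ) : ℂ) -
        (m : ℂ) * ((Kerr.starAngle M a r : ℝ) : ℂ)))) * f r)
    (hRd : DifferentiableOn ℝ R (Ioi (Kerr.rPlus M a)))
    (hdec : ∀ r : ℝ, Kerr.rPlus M a + 1 ≤ r →
      ‖R r‖ ≤ C * Real.exp (-(κ * r)) ∧ ‖deriv R r‖ ≤ C * Real.exp (-(κ * r))) :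
    ∃ C' : ℝ, DifferentiableOn ℝ (ksRadial M a w m R) (Ioi (Kerr.rPlus M a)) ∧
      ∀ r ∈ Ioi (Kerr.rPlus M a), ‖ksRadial M a w m R r‖ ≤ C' * Real.exp (-(κ * r)) ∧
        ‖deriv (ksRadial M a w m R) r‖ ≤ C' * Real.exp (-(κ * r)) := by
  set rp : ℝ := Kerr.rPlus M a with hrp_def
  have hrp : 0 < rp := hMa.rPlus_pos
  -- the factor `e^{−iωr} f` and its derivative
  set g : ℝ → ℂ := fun r ↦ Complex.exp (-(Complex.I * w) * (r : ℂ)) * f r with hg_def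
  have hsub : Ioi rp ⊆ Ioi (rp - η) := Ioi_subset_Ioi (by linarith)
  have hfd : ∀ r ∈ Ioi (rp - η), HasDerivAt f (deriv f r) r := fun r hr ↦
    ((hf.differentiableOn (by simp)).differentiableAt (Ioi_mem_nhds hr)).hasDerivAt
  have hE : ∀ r : ℝ, HasDerivAt (fun s : ℝ ↦ Complex.exp (-(Complex.I * w) * (s : ℂ)))
      (Complex.exp (-(Complex.I * w) * (r : ℂ)) * (-(Complex.I * w))) r := by
    intro r
    have h := ((hasDerivAt_id r).ofReal_comp.const_mul (-(Complex.I * w))).cexp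
    simpa using h
  have hgd : ∀ r ∈ Ioi (rp - η), HasDerivAt g (Complex.exp (-(Complex.I * w) * (r : ℂ)) *
      (-(Complex.I * w)) * f r + Complex.exp (-(Complex.I * w) * (r : ℂ)) * deriv f r) r :=
    fun r hr ↦ (hE r).mul (hfd r hr)
  have hnormE : ∀ r : ℝ, ‖Complex.exp (-(Complex.I * w) * (r : ℂ))‖ = Real.exp (w.im * r) := by
    intro r
    rw [Complex.norm_exp]
    simp
  -- `ksRadial = g` on `(r₊, ∞)`
  have heq : EqOn (ksRadial M a w m R) g (Ioi rp) := fun r hr ↦ ksRadial_eq hRf hr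
  have hdiff : DifferentiableOn ℝ (ksRadial M a w m R) (Ioi rp) := fun r hr ↦
    (((hgd r (hsub hr)).differentiableAt).congr_of_eventuallyEq
      (eventuallyEq_of_mem (Ioi_mem_nhds hr) heq)).differentiableWithinAt
  have hderiv : ∀ r ∈ Ioi rp, deriv (ksRadial M a w m R) r = deriv g r := fun r hr ↦
    (eventuallyEq_of_mem (Ioi_mem_nhds hr) heq).deriv_eq
  -- bounds for `f`, `f'` on `[r₊, r₊ + 1]`
  have hK : IsCompact (Icc rp (rp + 1)) := isCompact_Icc
  have hKsub : Icc rp (rp + 1) ⊆ Ioi (rp - η) := fun r hr ↦ lt_of_lt_of_le (by linarith) hr.1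
  obtain ⟨F₀, hF₀⟩ := hK.exists_bound_of_continuousOn (hf.continuousOn.mono hKsub)
  obtain ⟨F₁, hF₁⟩ := hK.exists_bound_of_continuousOn
    ((hf.continuousOn_deriv_of_isOpen isOpen_Ioi (by simp)).mono hKsub)
  have hF₀0 : 0 ≤ F₀ := (norm_nonneg _).trans (hF₀ rp ⟨le_rfl, by linarith⟩)
  have hF₁0 : 0 ≤ F₁ := (norm_nonneg _).trans (hF₁ rp ⟨le_rfl, by linarith⟩)
  have hC0 : 0 ≤ C := by
    have h := (hdec (rp + 1) le_rfl).1
    exact le_of_mul_le_mul_right ((norm_nonneg _).trans h |> le_of_eq_of_le (by ring)) (Real.exp_pos _)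
  -- the constants
  set A : ℝ := Real.exp (w.im * (rp + 1)) * Real.exp (κ * (rp + 1)) with hA
  set P₀ : ℝ := Real.exp (2 * M * Kerr.rMinus M a * w.im) with hP₀
  set D₀ : ℝ := 2 * M * ‖w‖ * (1 + rp) + |a * m| with hD₀
  have hM : 0 < M := hMa.pos
  have hA0 : 0 < A := by positivity
  have hP₀0 : 0 < P₀ := by positivity
  have hD₀0 : 0 ≤ D₀ :=
    add_nonneg (mul_nonneg (mul_nonneg (by positivity) (norm_nonneg w)) (by positivity)) (abs_nonneg _)
  set C' : ℝ := A * F₀ + A * (‖w‖ * F₀ + F₁) + P₀ * C * (D₀ + 1) with hC'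
  have hC'1 : A * F₀ ≤ C' := by
    have : 0 ≤ A * (‖w‖ * F₀ + F₁) + P₀ * C * (D₀ + 1) := by positivity
    linarith
  have hC'2 : A * (‖w‖ * F₀ + F₁) ≤ C' := by
    have : 0 ≤ A * F₀ + P₀ * C * (D₀ + 1) := by positivity
    linarith
  have hC'3 : P₀ * C ≤ C' := by
    have : 0 ≤ A * F₀ + A * (‖w‖ * F₀ + F₁) + P₀ * C * D₀ := by positivity
    linarith
  have hC'4 : P₀ * C * (D₀ + 1) ≤ C' := by
    have : 0 ≤ A * F₀ + A * (‖w‖ * F₀ + F₁) := by positivity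
    linarith
  refine ⟨C', hdiff, fun r hr ↦ ?_⟩
  have hr' : rp < r := hr
  have hr0 : 0 < r := hrp.trans hr'
  have hexp : 0 < Real.exp (-(κ * r)) := Real.exp_pos _
  rcases le_or_gt r (rp + 1) with hle | hgt
  · -- near the horizon: `r ∈ (r₊, r₊ + 1]`
    have hrK : r ∈ Icc rp (rp + 1) := ⟨hr'.le, hle⟩
    have hEA : Real.exp (w.im * r) ≤ A * Real.exp (-(κ * r)) := by
      rw [hA, mul_assoc, ← Real.exp_add, ← Real.exp_add, Real.exp_le_exp]
      nlinarith [mul_le_mul_of_nonneg_left hle hw, mul_le_mul_of_nonneg_left hle hκ.le]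
    constructor
    · rw [heq hr, hg_def, norm_mul, hnormE]
      calc Real.exp (w.im * r) * ‖f r‖ ≤ A * Real.exp (-(κ * r)) * F₀ := by
            gcongr; exact hF₀ r hrK
        _ = A * F₀ * Real.exp (-(κ * r)) := by ring
        _ ≤ C' * Real.exp (-(κ * r)) := by gcongr
    · rw [hderiv r hr, (hgd r (hsub hr)).deriv]
      calc ‖Complex.exp (-(Complex.I * w) * (r : ℂ)) * (-(Complex.I * w)) * f r +
              Complex.exp (-(Complex.I * w) * (r : ℂ)) * deriv f r‖
          ≤ ‖Complex.exp (-(Complex.I * w) * (r : ℂ)) * (-(Complex.I * w)) * f r‖ +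
              ‖Complex.exp (-(Complex.I * w) * (r : ℂ)) * deriv f r‖ := norm_add_le _ _
        _ = Real.exp (w.im * r) * (‖w‖ * ‖f r‖ + ‖deriv f r‖) := by
            rw [norm_mul, norm_mul, norm_mul, hnormE, norm_neg, norm_mul, Complex.norm_I, one_mul]
            ring
        _ ≤ A * Real.exp (-(κ * r)) * (‖w‖ * F₀ + F₁) := by
            gcongr
            · exact hF₀ r hrK
            · exact hF₁ r hrK
        _ = A * (‖w‖ * F₀ + F₁) * Real.exp (-(κ * r)) := by ring
        _ ≤ C' * Real.exp (-(κ * r)) := by gcongr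
  · -- at infinity: `r ≥ r₊ + 1`
    have hge : rp + 1 ≤ r := hgt.le
    have hph : ‖ksPhase M a w m r‖ ≤ P₀ := norm_ksPhase_le hMa hw m hge
    have hRr := (hdec r hge).1
    have hR'r := (hdec r hge).2
    constructor
    · rw [ksRadial, norm_mul]
      calc ‖ksPhase M a w m r‖ * ‖R r‖ ≤ P₀ * (C * Real.exp (-(κ * r))) := by gcongr
        _ = P₀ * C * Real.exp (-(κ * r)) := by ring
        _ ≤ C' * Real.exp (-(κ * r)) := by gcongr
    · have hRd' : HasDerivAt R (deriv R r) r := (hRd.differentiableAt (Ioi_mem_nhds hr)).hasDerivAt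
      have hprod := (hasDerivAt_ksPhase hMa w m hr').mul hRd'
      have hfun : ksRadial M a w m R = ksPhase M a w m * R := rfl
      rw [hfun, hprod.deriv]
      set FAC : ℂ := Complex.I * (w * (((r ^ 2 + a ^ 2) / Kerr.delta M a r - 1 : ℝ) : ℂ) -
        (m : ℂ) * ((a / Kerr.delta M a r : ℝ) : ℂ)) with hFAC
      have hfac : ‖FAC‖ ≤ D₀ := norm_phaseFactor_le hMa w m hge
      clear_value FAC
      calc ‖ksPhase M a w m r * FAC * R r + ksPhase M a w m r * deriv R r‖
          ≤ ‖ksPhase M a w m r * FAC * R r‖ + ‖ksPhase M a w m r * deriv R r‖ := norm_add_le _ _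
        _ = ‖ksPhase M a w m r‖ * ‖FAC‖ * ‖R r‖ + ‖ksPhase M a w m r‖ * ‖deriv R r‖ := by
            rw [norm_mul, norm_mul, norm_mul]
        _ ≤ P₀ * D₀ * (C * Real.exp (-(κ * r))) + P₀ * (C * Real.exp (-(κ * r))) := by
            gcongr
        _ = P₀ * C * (D₀ + 1) * Real.exp (-(κ * r)) := by ring
        _ ≤ C' * Real.exp (-(κ * r)) := by gcongr

end Radial

/-! ### Glue, II: the leaf profile — smoothness, non-vanishing, decay -/

section Profile

variable {a r₀ : ℝ} {g : ℝ → ℂ} {Y : E3 → ℂ}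

/-- **The leaf profile is `C^∞` on the slice `{r > r₀}`** when the radial factor is `C^∞` on
`(r₀, ∞)` and the angular factor is `C^∞` off the origin (`r(0, ·)` and `ℓ⃗(0, ·)` are smooth on
the slice, `|ℓ⃗| = 1`). Rendering deviation (i) of `ShlapentokhRothman2014_unstableModeProfile`, proved.
[folklore] -/
theorem contDiffOn_ksProfile (hg : ContDiffOn ℝ ∞ g (Ioi r₀)) (hY : ContDiffOn ℝ ∞ Y {n : E3 | n ≠ 0}) :
    ContDiffOn ℝ ∞ (ksProfile a g Y) (Kerr.slice a r₀) := by
  intro y hy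
  have hr : 0 < Kerr.radius a (E4.ofTimeSpace 0 y) := Kerr.radius_pos_of_mem_slice hy
  have hr₀ : r₀ < Kerr.radius a (E4.ofTimeSpace 0 y) := Kerr.lt_radius_of_mem_slice hy
  have h1 : ContDiffAt ℝ ∞ (fun y : E3 ↦ Kerr.radius a (E4.ofTimeSpace 0 y)) y :=
    Kerr.contDiffAt_radius_slice hr
  have h2 : ContDiffAt ℝ ∞ g (Kerr.radius a (E4.ofTimeSpace 0 y)) :=
    hg.contDiffAt (Ioi_mem_nhds hr₀)
  have h3 : ContDiffAt ℝ ∞ (fun y : E3 ↦ Kerr.nullSpatial a (E4.ofTimeSpace 0 y)) y := by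
    have h : ContDiffAt ℝ ∞ (fun y : E3 ↦ Kerr.nullVector a (E4.ofTimeSpace 0 y)) y :=
      (Kerr.contDiffAt_nullVector a hr (n := ∞)).comp y (E4.contDiff_ofTimeSpace 0).contDiffAt
    exact E4.spatial.contDiff.contDiffAt.comp y h
  have h4 : ContDiffAt ℝ ∞ Y (Kerr.nullSpatial a (E4.ofTimeSpace 0 y)) :=
    hY.contDiffAt (isOpen_ne.mem_nhds (Kerr.nullSpatial_slice_ne_zero hr))
  exact ((h2.comp y h1).mul (h4.comp y h3)).contDiffWithinAt

/-- **The leaf profile at a point with Kerr-star coordinates `(r, θ, φ*)`**: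
`Φ(Y_a(r, θ, φ*)) = g(r) Y(n̂(θ, φ*))` (`r > 0`; `Kerr.radius_kerrStar`, `Kerr.nullSpatial_kerrStar`).
[folklore] -/
theorem ksProfile_kerrStar (a : ℝ) (g : ℝ → ℂ) (Y : E3 → ℂ) {r : ℝ} (hr : 0 < r) (θ φ : ℝ) :
    ksProfile a g Y (Kerr.kerrStar a r θ φ) = g r * Y (sphRadial θ φ) := by
  rw [ksProfile, Kerr.radius_kerrStar a hr, Kerr.nullSpatial_kerrStar a hr]

/-- A function `C^∞` off the origin and its Fréchet derivative are bounded on the unit sphere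
(compactness). [folklore] -/
theorem exists_bound_sphere (hY : ContDiffOn ℝ ∞ Y {n : E3 | n ≠ 0}) :
    ∃ B : ℝ, 0 ≤ B ∧ ∀ n : E3, ‖n‖ = 1 → ‖Y n‖ ≤ B ∧ ‖fderiv ℝ Y n‖ ≤ B := by
  have hsub : Metric.sphere (0 : E3) 1 ⊆ {n : E3 | n ≠ 0} := by
    intro n hn h0
    rw [mem_sphere_zero_iff_norm, h0, norm_zero] at hn
    exact zero_ne_one hn
  have hK : IsCompact (Metric.sphere (0 : E3) 1) := isCompact_sphere 0 1
  obtain ⟨B₀, hB₀⟩ := hK.exists_bound_of_continuousOn (hY.continuousOn.mono hsub)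
  obtain ⟨B₁, hB₁⟩ := hK.exists_bound_of_continuousOn
    ((hY.continuousOn_fderiv_of_isOpen isOpen_ne (by simp)).mono hsub)
  refine ⟨max (max B₀ B₁) 0, le_max_right _ _, fun n hn ↦ ?_⟩
  have hmem : n ∈ Metric.sphere (0 : E3) 1 := mem_sphere_zero_iff_norm.2 hn
  exact ⟨(hB₀ n hmem).trans ((le_max_left _ _).trans (le_max_left _ _)),
    (hB₁ n hmem).trans ((le_max_right _ _).trans (le_max_left _ _))⟩

/-- **Exponential decay of the leaf profile and of its Fréchet derivative** on the slice
`{r > r₀}` (`r₀ > 0`): if `‖g(r)‖, ‖g'(r)‖ ≤ C e^{−κr}` on `(r₀, ∞)` and `Y` is `C^∞` off the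
origin, then `‖Φ(y)‖, ‖DΦ(y)‖ ≤ C' e^{−κ‖y‖}` on the slice, with
`DΦ = (g' dr) Y(ℓ⃗) + g · DY(ℓ⃗) ∘ Dℓ⃗`, the uniform chart bounds `‖dr‖ ≤ 1 + |a|/r₀`,
`‖Dℓ⃗‖ ≤ (21(1 + |a|/r₀) + 5)/r₀` (`KerrStarChartBounds.lean`), the sphere bounds for `Y`, and
`r ≥ ‖y‖ − |a|`. Rendering deviation (iii) of `ShlapentokhRothman2014_unstableModeProfile`, proved.
[folklore] -/
theorem exists_decay_ksProfile (hr₀ : 0 < r₀) {C κ : ℝ} (hκ : 0 < κ)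
    (hgd : DifferentiableOn ℝ g (Ioi r₀))
    (hg : ∀ r ∈ Ioi r₀, ‖g r‖ ≤ C * Real.exp (-(κ * r)) ∧ ‖deriv g r‖ ≤ C * Real.exp (-(κ * r)))
    (hY : ContDiffOn ℝ ∞ Y {n : E3 | n ≠ 0}) :
    ∃ C' : ℝ, ∀ y ∈ Kerr.slice a r₀,
      ‖ksProfile a g Y y‖ ≤ C' * Real.exp (-(κ * ‖y‖)) ∧
        ‖fderiv ℝ (ksProfile a g Y) y‖ ≤ C' * Real.exp (-(κ * ‖y‖)) := by
  obtain ⟨B, hB0, hB⟩ := exists_bound_sphere hY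
  set K : ℝ := 1 + |a| / r₀ with hK
  set KL : ℝ := (21 * (1 + |a| / r₀) + 5) / r₀ with hKL
  have hK0 : 0 ≤ K := by positivity
  have hKL0 : 0 ≤ KL := by positivity
  have hC0 : 0 ≤ C := by
    have h := (hg (r₀ + 1) (by simp)).1
    nlinarith [norm_nonneg (g (r₀ + 1)), Real.exp_pos (-(κ * (r₀ + 1)))]
  set C' : ℝ := Real.exp (κ * |a|) * C * B * (1 + K + KL) with hC'
  have hbase : Real.exp (κ * |a|) * C * B ≤ C' := by
    have : 0 ≤ Real.exp (κ * |a|) * C * B * (K + KL) := by positivity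
    linarith
  refine ⟨C', fun y hy ↦ ?_⟩
  have hr : 0 < Kerr.radius a (E4.ofTimeSpace 0 y) := Kerr.radius_pos_of_mem_slice hy
  have hr₀r : r₀ < Kerr.radius a (E4.ofTimeSpace 0 y) := Kerr.lt_radius_of_mem_slice hy
  set r : ℝ := Kerr.radius a (E4.ofTimeSpace 0 y) with hrdef
  set n : E3 := Kerr.nullSpatial a (E4.ofTimeSpace 0 y) with hndef
  have hn1 : ‖n‖ = 1 := Kerr.norm_nullSpatial_slice hr
  have hn0 : n ≠ 0 := Kerr.nullSpatial_slice_ne_zero hr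
  have hexp : Real.exp (-(κ * r)) ≤ Real.exp (κ * |a|) * Real.exp (-(κ * ‖y‖)) := by
    rw [← Real.exp_add, Real.exp_le_exp]
    have h := Kerr.norm_le_radius_add_abs hr
    nlinarith
  have hgr := (hg r hr₀r).1
  have hg'r := (hg r hr₀r).2
  have hYn := (hB n hn1).1
  have hDYn := (hB n hn1).2
  have hE0 : 0 ≤ Real.exp (-(κ * ‖y‖)) := (Real.exp_pos _).le
  constructor
  · rw [ksProfile, norm_mul]
    calc ‖g r‖ * ‖Y n‖ ≤ C * Real.exp (-(κ * r)) * B := by gcongr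
      _ ≤ C * (Real.exp (κ * |a|) * Real.exp (-(κ * ‖y‖))) * B := by gcongr
      _ = Real.exp (κ * |a|) * C * B * Real.exp (-(κ * ‖y‖)) := by ring
      _ ≤ C' * Real.exp (-(κ * ‖y‖)) := by gcongr
  · obtain ⟨L', hL', hL'b⟩ := Kerr.exists_hasFDerivAt_nullSpatial_slice hr₀ hy
    have hdr : HasFDerivAt (fun y : E3 ↦ Kerr.radius a (E4.ofTimeSpace 0 y)) (Kerr.radiusGrad a y) y :=
      Kerr.hasFDerivAt_radius_slice hr
    have hdrb : ‖Kerr.radiusGrad a y‖ ≤ K := Kerr.norm_radiusGrad_le hr₀ hy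
    have hgd' : HasDerivAt g (deriv g r) r := (hgd.differentiableAt (Ioi_mem_nhds hr₀r)).hasDerivAt
    have h1 : HasFDerivAt (fun y : E3 ↦ g (Kerr.radius a (E4.ofTimeSpace 0 y)))
        ((ContinuousLinearMap.smulRight (1 : ℝ →L[ℝ] ℝ) (deriv g r)).comp (Kerr.radiusGrad a y)) y :=
      hgd'.hasFDerivAt.comp y hdr
    have hsr : ‖ContinuousLinearMap.smulRight (1 : ℝ →L[ℝ] ℝ) (deriv g r)‖ ≤ ‖deriv g r‖ :=
      ContinuousLinearMap.opNorm_le_bound _ (norm_nonneg _) fun t ↦ by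
        change ‖t • deriv g r‖ ≤ ‖deriv g r‖ * ‖t‖
        rw [norm_smul, mul_comm]
    have hYd : DifferentiableAt ℝ Y n :=
      (hY.differentiableOn (by simp)).differentiableAt (isOpen_ne.mem_nhds hn0)
    have h2 : HasFDerivAt (fun y : E3 ↦ Y (Kerr.nullSpatial a (E4.ofTimeSpace 0 y)))
        ((fderiv ℝ Y n).comp L') y := hYd.hasFDerivAt.comp y hL'
    have hprod := h1.mul h2
    have hfun : ksProfile a g Y = (fun y : E3 ↦ g (Kerr.radius a (E4.ofTimeSpace 0 y))) *
        fun y : E3 ↦ Y (Kerr.nullSpatial a (E4.ofTimeSpace 0 y)) := rfl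
    rw [hfun, hprod.fderiv]
    calc ‖g r • ((fderiv ℝ Y n).comp L') +
          Y n • ((ContinuousLinearMap.smulRight (1 : ℝ →L[ℝ] ℝ) (deriv g r)).comp (Kerr.radiusGrad a y))‖
        ≤ ‖g r • ((fderiv ℝ Y n).comp L')‖ +
          ‖Y n • ((ContinuousLinearMap.smulRight (1 : ℝ →L[ℝ] ℝ) (deriv g r)).comp (Kerr.radiusGrad a y))‖ :=
          norm_add_le _ _
      _ ≤ ‖g r‖ * (‖fderiv ℝ Y n‖ * ‖L'‖) + ‖Y n‖ * (‖deriv g r‖ * ‖Kerr.radiusGrad a y‖) := by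
          refine add_le_add ?_ ?_
          · refine (norm_smul_le (g r) ((fderiv ℝ Y n).comp L')).trans ?_
            gcongr
            exact ContinuousLinearMap.opNorm_comp_le _ _
          · refine (norm_smul_le (Y n) ((ContinuousLinearMap.smulRight (1 : ℝ →L[ℝ] ℝ)
              (deriv g r)).comp (Kerr.radiusGrad a y))).trans ?_
            gcongr
            exact (ContinuousLinearMap.opNorm_comp_le _ _).trans (by gcongr)
      _ ≤ C * Real.exp (-(κ * r)) * (B * KL) + B * (C * Real.exp (-(κ * r)) * K) := by gcongr
      _ = C * B * (K + KL) * Real.exp (-(κ * r)) := by ring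
      _ ≤ C * B * (K + KL) * (Real.exp (κ * |a|) * Real.exp (-(κ * ‖y‖))) := by gcongr
      _ ≤ C' * Real.exp (-(κ * ‖y‖)) := by
          rw [hC']
          have : 0 ≤ Real.exp (κ * |a|) * C * B * Real.exp (-(κ * ‖y‖)) := by positivity
          nlinarith

end Profile

/-! ### The reduction: separated mode theorem + Carter separation ⟹ the profile fact -/

/-- **`CarterSeparationKSLeaf` + `ShlapentokhRothman2014_separatedMode` ⟹
`ShlapentokhRothman2014_unstableModeProfile`.** From the separated data `(μ, ω, λ, S, Y, R, f)` of
the mode theorem, the leaf profile `Φ = ksProfile a (ksRadial M a ω m R) Y` is `C^∞` on the slice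
(`contDiffOn_ksProfile`, with `ksRadial = e^{−iωr} f` smooth on `(r₊, ∞)`), does not vanish at the
point `Y_a(r₁, θ₀, 0)` where `R(r₁) ≠ 0`, `S(θ₀) ≠ 0` (`ksProfile_kerrStar`), decays with
its derivative like `e^{−κ‖y‖}` (`exists_bound_ksRadial`, `exists_decay_ksProfile`), and solves
`P_ω Φ = μ² Φ` on the slice (Carter separation); the parameter clauses are carried over.
Shlapentokh-Rothman, CMP 329 (2014), Thm. 1.2 and §2. [cite: ShlapentokhRothman2014KleinGordon, Thm. 1.2 and §2] -/
theorem ShlapentokhRothman2014_unstableModeProfile.of_separated (hC : CarterSeparationKSLeaf)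
    (hM : ShlapentokhRothman2014_separatedMode) : ShlapentokhRothman2014_unstableModeProfile := by
  intro _ _ M a hMa ha m hm δ hδ
  obtain ⟨μ, hμ, hμδ, w, hwim, hwre, hsup, Λ, S, Y, hS, hY, ⟨θ₀, hθ₀, hSθ₀⟩, R, f, hR, ⟨η, hη, hf⟩,
    hRf, ⟨r₁, hr₁, hRr₁⟩, C, κ, hκ, hdec⟩ := hM M a hMa ha m hm δ hδ
  have hrp : 0 < Kerr.rPlus M a := hMa.rPlus_pos
  obtain ⟨C₁, hgd, hg⟩ := exists_bound_ksRadial (m := m) hMa hwim.le hη hκ hf hRf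
    (hR.1.differentiableOn (by simp)) hdec
  -- the leaf radial factor is `e^{−iωr} f`, smooth on `(r₊, ∞)`
  have hgs : ContDiffOn ℝ ∞ (ksRadial M a w m R) (Ioi (Kerr.rPlus M a)) := by
    have hof : ContDiff ℝ ∞ (fun r : ℝ ↦ (r : ℂ)) := Complex.ofRealCLM.contDiff
    have h1 : ContDiffOn ℝ ∞ (fun r : ℝ ↦ Complex.exp (-(Complex.I * w) * (r : ℂ)) * f r)
        (Ioi (Kerr.rPlus M a)) :=
      ((contDiff_const.mul hof).cexp.contDiffOn).mul (hf.mono (Ioi_subset_Ioi (by linarith)))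
    exact h1.congr fun r hr ↦ ksRadial_eq hRf hr
  obtain ⟨C₂, hdecay⟩ := exists_decay_ksProfile (a := a) (Y := Y) hrp hκ hgd hg hY.1
  refine ⟨μ, hμ, hμδ, w, hwim, hwre, hsup, ksProfile a (ksRadial M a w m R) Y,
    contDiffOn_ksProfile hgs hY.1, ?_, ⟨C₂, κ, hκ, hdecay⟩,
    fun y hy ↦ hC M a hMa w m Λ μ S Y R hS hY hR y hy⟩
  -- non-vanishing at the point `Y_a(r₁, θ₀, 0)`
  have hr₁0 : 0 < r₁ := hrp.trans hr₁
  refine ⟨Kerr.kerrStar a r₁ θ₀ 0, Kerr.kerrStar_mem_slice (max_lt hr₁ hr₁0) θ₀ 0, ?_⟩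
  rw [ksProfile_kerrStar a _ Y hr₁0, hY.2.2 θ₀ hθ₀ 0, ksRadial]
  exact mul_ne_zero (mul_ne_zero (Complex.exp_ne_zero _) hRr₁)
    (mul_ne_zero (Complex.exp_ne_zero _) hSθ₀)

/-- **Separated mode theorem + Carter separation ⟹ the barrier fact** (composition with
`KleinGordonSuperradiantInstability.of_unstableModeProfile`). SR, CMP 329 (2014), Thm. 1.1 from
Thm. 1.2. [cite: ShlapentokhRothman2014KleinGordon, Thm. 1.1 and Thm. 1.2] -/
theorem KleinGordonSuperradiantInstability.of_separated (hC : CarterSeparationKSLeaf)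
    (hM : ShlapentokhRothman2014_separatedMode) : KleinGordonSuperradiantInstability :=
  KleinGordonSuperradiantInstability.of_unstableModeProfile
    (ShlapentokhRothman2014_unstableModeProfile.of_separated hC hM)

end Literature.Barriers.FinalStateConjecture

end
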